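import Mathlib
import Summits.QuantumFields.YangMills.Theorems.TransportFieldFanoVacuumElectricEnergy
import HarnessLib

/-!
# One temporal plaquette of the exact zero-flux vacuum: `∫∫ ΩK_βΩ·(4 − 2Re tr UₑVₑ⁻¹) ≤ (4/β)·λ₀·(6|E| − log c_L)` for `β ≥ 1`
# (route `TransportFieldFano`, crux ⟨stmt-QuantumFields-23362⟩ helper lane — the `w ≡ const` instance of the weighted temporal-plaquette mean)

Sequel to `…TransportFieldFanoVacuumElectricEnergy` (★★ `vacuum_electric_energy_le`: the SUMMED temporal plaquette of the vacuum pair measure is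
`≤ (2/β)λ₀(6|E| − log uniformFloorConst L)`).  Here one edge `e` is singled out: every term `2 − Re tr UₑVₑ⁻¹` of `2|E| − timeCoupling` is
non-negative, so after the Perron–Frobenius reduction to the non-negative representative `|c|Ω₊` of the eigenfunction (the pair weight
`Ω(U)K_β(U,V)Ω(V)` is even in `Ω`), a single term is bounded by the sum:
★ `vacuum_link_plaquette_le` — `∫∫ Ω(U)K_β(U,V)Ω(V)(4 − 2Re tr UₑVₑ⁻¹) ≤ (4/β)·λ₀·(6|E| − log uniformFloorConst L)` for EVERY `l2`-normalised
physical `Ω` with `K_βΩ = λ₀Ω`, every edge `e`, every `L`, `β ≥ 1`.  This is the quantity of stub `stub_dWeightedPlaquetteMean` of ⟨23362⟩ (and of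
stub 3 of ⟨23354⟩) with the torelon weight `d_x(U)+d_x(V) ∈ [0, 8]` replaced by a constant: the stub's left side is therefore
`≤ (32/β)λ₀(6|E| − log c_L) = O(L³ log L/β)·λ₀` unconditionally; what the stub asks beyond this is the factor `E[FΩ²]` on the right (a torelon-mean
floor).  HONEST FRAMING: fixed-lattice helper estimate (`--supports 23362`); no stub, crux, rung or summit statement is proved; nothing about
infinite volume, the continuum or the Yang–Mills mass gap.  No `sorry`, no new definition.
References: [cite: ReedSimonIV1978, Thm. XIII.43]; [cite: Luscher1983, §2].
-/

set_option autoImplicit false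

noncomputable section

open MeasureTheory Filter Topology Real
open Literature.MathematicalPhysics.QuantumFieldTheory (GaugeConfig Site Edge Plaquette gaugeTransform wilsonAction)
open Literature.MathematicalPhysics.QuantumLattice (fundamentalRep_apply secondCountableTopology_su2)

namespace Summit.QuantumFields.YangMills.Theorems.TransportFieldFano

open Summit.QuantumFields.YangMills.Theorems.FemtoTransferGap
open Summit.QuantumFields.YangMills.Theorems.AdjointLoopFano

variable {L : ℕ} [NeZero L]

/-! ## §4 One temporal plaquette -/

/-- ★ **One temporal plaquette of the exact vacuum** (`β ≥ 1`; every edge `e`; every `l2`-normalised physical `Ω` with `K_βΩ = λ₀Ω`):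
`∫∫ Ω(U)K_β(U,V)Ω(V)·(4 − 2Re tr UₑVₑ⁻¹) ≤ (4/β)·λ₀·(6|E| − log uniformFloorConst L)` — the `w ≡ const` instance of the weighted temporal
plaquette mean of LINE g17-A (twice one term of the non-negative sum `2|E| − timeCoupling`). [cite: Luscher1983, §2] -/
theorem vacuum_link_plaquette_le {β : ℝ} (hβ : 1 ≤ β) {Ω : GaugeConfig 3 L SU2 → ℝ} (hΩ : IsPhys Ω)
    (hn : l2 Ω Ω = 1) (heig : transferApply β Ω = topValue su2Rep L β • Ω) (e : Edge 3 L) :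
    ∫ p, Ω p.1 * transferKernel su2Rep β p.1 p.2 * Ω p.2 *
        (4 - 2 * ((((p.1 e * (p.2 e)⁻¹ : SU2) : Matrix (Fin 2) (Fin 2) ℂ)).trace).re)
        ∂(configMeasure SU2 L).prod (configMeasure SU2 L) ≤
      (4 / β) * topValue su2Rep L β * (6 * Fintype.card (Edge 3 L) - Real.log (uniformFloorConst L)) := by
  haveI : SecondCountableTopology SU2 := secondCountableTopology_su2
  have hβ0 : 0 < β := by linarith
  -- reduce to the non-negative representative (the pair weight is even in `Ω`)
  obtain ⟨Ωp, θ, cp, hΩp, hcp, hΩpge, hnp, heigp, -, hθ, hgap⟩ := PhysL2.exists_groundState (L := L) β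
  set c : ℝ := l2 Ω Ωp with hc
  have hae : Ω =ᵐ[configMeasure SU2 L] fun U => c * Ωp U := ae_eq_smul_groundState hΩ hΩp hnp heig heigp hθ hgap
  set Ω'' : GaugeConfig 3 L SU2 → ℝ := fun U => |c| * Ωp U with hΩ''_def
  have hΩ'' : IsPhys Ω'' := by
    have h := hΩp.smul |c|
    have e' : (|c| • Ωp) = Ω'' := by funext U; simp [hΩ''_def]
    rw [← e']; exact h
  have hΩ''nn : ∀ U, 0 ≤ Ω'' U := fun U => mul_nonneg (abs_nonneg c) (hcp.le.trans (hΩpge U))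
  have heig'' : transferApply β Ω'' = topValue su2Rep L β • Ω'' := by
    have e' : Ω'' = |c| • Ωp := by funext U; simp [hΩ''_def]
    rw [e', transferApply_smul, heigp, smul_smul, smul_smul, mul_comm]
  have hsq : ∀ U, Ω U = c * Ωp U → ∀ V, Ω V = c * Ωp V → Ω U * Ω V = Ω'' U * Ω'' V := fun U hU V hV => by
    rw [hU, hV, hΩ''_def]; dsimp only
    have : c * Ωp U * (c * Ωp V) = c * c * (Ωp U * Ωp V) := by ring
    rw [this, ← sq, ← sq_abs c]; ring
  have hn'' : l2 Ω'' Ω'' = 1 := by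
    rw [← hn]; unfold l2
    refine integral_congr_ae ?_
    filter_upwards [hae] with U hU
    exact (hsq U hU U hU).symm
  have hfst : (fun p : GaugeConfig 3 L SU2 × GaugeConfig 3 L SU2 => Ω p.1) =ᵐ[(configMeasure SU2 L).prod (configMeasure SU2 L)]
      fun p => c * Ωp p.1 :=
    (Measure.quasiMeasurePreserving_fst (μ := configMeasure SU2 L) (ν := configMeasure SU2 L)).ae_eq hae
  have hsnd : (fun p : GaugeConfig 3 L SU2 × GaugeConfig 3 L SU2 => Ω p.2) =ᵐ[(configMeasure SU2 L).prod (configMeasure SU2 L)]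
      fun p => c * Ωp p.2 :=
    (Measure.quasiMeasurePreserving_snd (μ := configMeasure SU2 L) (ν := configMeasure SU2 L)).ae_eq hae
  have hRHS : ∀ G : GaugeConfig 3 L SU2 × GaugeConfig 3 L SU2 → ℝ,
      ∫ p, Ω p.1 * transferKernel su2Rep β p.1 p.2 * Ω p.2 * G p ∂(configMeasure SU2 L).prod (configMeasure SU2 L) =
      ∫ p, Ω'' p.1 * transferKernel su2Rep β p.1 p.2 * Ω'' p.2 * G p ∂(configMeasure SU2 L).prod (configMeasure SU2 L) := by
    intro G
    refine integral_congr_ae ?_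
    filter_upwards [hfst, hsnd] with p h1 h2
    have h := hsq p.1 h1 p.2 h2
    calc Ω p.1 * transferKernel su2Rep β p.1 p.2 * Ω p.2 * G p = (Ω p.1 * Ω p.2) * transferKernel su2Rep β p.1 p.2 * G p := by ring
      _ = (Ω'' p.1 * Ω'' p.2) * transferKernel su2Rep β p.1 p.2 * G p := by rw [h]
      _ = Ω'' p.1 * transferKernel su2Rep β p.1 p.2 * Ω'' p.2 * G p := by ring
  rw [hRHS]
  -- the single-edge term is non-negative and at most twice the sum
  have htot := vacuum_electric_energy_le_of_nonneg hβ hΩ'' hΩ''nn hn'' heig''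
  obtain ⟨CΩ, hCΩ⟩ := hΩ''.bounded
  have hCΩ0 : 0 ≤ CΩ := (abs_nonneg _).trans (hCΩ (fun _ => 1))
  set w : GaugeConfig 3 L SU2 × GaugeConfig 3 L SU2 → ℝ := fun p => Ω'' p.1 * transferKernel su2Rep β p.1 p.2 * Ω'' p.2 with hw_def
  have hw0 : ∀ p, 0 ≤ w p := fun p =>
    mul_nonneg (mul_nonneg (hΩ''nn _) (transferKernel_pos _ _ _ _).le) (hΩ''nn _)
  have hwm : Measurable w := ((hΩ''.measurable.comp measurable_fst).mul (measurable_transferKernel_lat β)).mul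
    (hΩ''.measurable.comp measurable_snd)
  have hwb : ∀ p, |w p| ≤ CΩ * Real.exp (2 * β) ^ Fintype.card (Edge 3 L) * CΩ := fun p => by
    rw [hw_def]; dsimp only; rw [abs_mul, abs_mul]
    exact mul_le_mul (mul_le_mul (hCΩ _) (abs_transferKernel_le_lat hβ0.le p) (abs_nonneg _) hCΩ0) (hCΩ _) (abs_nonneg _)
      (by positivity)
  -- single-link and summed deficits
  set d : Edge 3 L → GaugeConfig 3 L SU2 × GaugeConfig 3 L SU2 → ℝ :=
    fun f p => 2 - ((((p.1 f * (p.2 f)⁻¹ : SU2) : Matrix (Fin 2) (Fin 2) ℂ)).trace).re with hd_def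
  have hd0 : ∀ f p, 0 ≤ d f p := fun f p => by
    rw [hd_def]; dsimp only; linarith [re_trace_le_two (p.1 f * (p.2 f)⁻¹)]
  have hd4 : ∀ f p, d f p ≤ 4 := fun f p => by
    rw [hd_def]; dsimp only; linarith [neg_two_le_re_trace (p.1 f * (p.2 f)⁻¹)]
  have hdm : ∀ f, Measurable (d f) := fun f => by
    have hc : Continuous fun p : GaugeConfig 3 L SU2 × GaugeConfig 3 L SU2 => (p.1 f * (p.2 f)⁻¹ : SU2) :=
      ((continuous_apply f).comp continuous_fst).mul ((continuous_apply f).comp continuous_snd).inv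
    have hc2 : Continuous fun p : GaugeConfig 3 L SU2 × GaugeConfig 3 L SU2 =>
        ((((p.1 f * (p.2 f)⁻¹ : SU2) : Matrix (Fin 2) (Fin 2) ℂ)).trace).re :=
      Complex.continuous_re.comp ((continuous_subtype_val.comp hc).matrix_trace)
    exact (continuous_const.sub hc2).measurable
  have hsum : ∀ p : GaugeConfig 3 L SU2 × GaugeConfig 3 L SU2,
      2 * (Fintype.card (Edge 3 L) : ℝ) - timeCoupling su2Rep p.1 p.2 = ∑ f : Edge 3 L, d f p := fun p => by
    unfold timeCoupling
    rw [hd_def]; dsimp only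
    rw [Finset.sum_sub_distrib, Finset.sum_const, Finset.card_univ, nsmul_eq_mul, mul_comm]
    simp only [fundamentalRep_apply]
  have hint : ∀ f, Integrable (fun p => w p * d f p) ((configMeasure SU2 L).prod (configMeasure SU2 L)) := fun f =>
    integrable_latProd (hwm.mul (hdm f)) (C := CΩ * Real.exp (2 * β) ^ Fintype.card (Edge 3 L) * CΩ * 4) fun p => by
      rw [abs_mul, abs_of_nonneg (hd0 f p)]; exact mul_le_mul (hwb p) (hd4 f p) (hd0 f p) (by positivity)
  have hsingle : ∫ p, w p * d e p ∂(configMeasure SU2 L).prod (configMeasure SU2 L) ≤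
      ∫ p, w p * (2 * Fintype.card (Edge 3 L) - timeCoupling su2Rep p.1 p.2) ∂(configMeasure SU2 L).prod (configMeasure SU2 L) := by
    have hre : (fun p => w p * (2 * Fintype.card (Edge 3 L) - timeCoupling su2Rep p.1 p.2)) = fun p => ∑ f : Edge 3 L, w p * d f p := by
      funext p; rw [hsum p, Finset.mul_sum]
    rw [hre, integral_finsetSum _ fun f _ => hint f]
    have hnn : ∀ f ∈ (Finset.univ : Finset (Edge 3 L)),
        (0 : ℝ) ≤ ∫ p, w p * d f p ∂(configMeasure SU2 L).prod (configMeasure SU2 L) :=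
      fun f _ => integral_nonneg fun p => mul_nonneg (hw0 p) (hd0 f p)
    exact Finset.single_le_sum hnn (Finset.mem_univ e)
  have hconv : (fun p : GaugeConfig 3 L SU2 × GaugeConfig 3 L SU2 => Ω'' p.1 * transferKernel su2Rep β p.1 p.2 * Ω'' p.2 *
      (4 - 2 * ((((p.1 e * (p.2 e)⁻¹ : SU2) : Matrix (Fin 2) (Fin 2) ℂ)).trace).re)) = fun p => 2 * (w p * d e p) := by
    funext p; rw [hw_def, hd_def]; ring
  have htot' : ∫ p, w p * (2 * Fintype.card (Edge 3 L) - timeCoupling su2Rep p.1 p.2) ∂(configMeasure SU2 L).prod (configMeasure SU2 L) ≤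
      (2 / β) * topValue su2Rep L β * (6 * Fintype.card (Edge 3 L) - Real.log (uniformFloorConst L)) := by
    have : (fun p => w p * (2 * Fintype.card (Edge 3 L) - timeCoupling su2Rep p.1 p.2)) = fun p =>
        Ω'' p.1 * transferKernel su2Rep β p.1 p.2 * Ω'' p.2 * (2 * Fintype.card (Edge 3 L) - timeCoupling su2Rep p.1 p.2) := by
      funext p; rw [hw_def]
    rw [this]; exact htot
  rw [hconv, integral_const_mul]
  calc 2 * ∫ p, w p * d e p ∂(configMeasure SU2 L).prod (configMeasure SU2 L)
      ≤ 2 * ((2 / β) * topValue su2Rep L β * (6 * Fintype.card (Edge 3 L) - Real.log (uniformFloorConst L))) :=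
        mul_le_mul_of_nonneg_left (hsingle.trans htot') (by norm_num)
    _ = _ := by ring

end Summit.QuantumFields.YangMills.Theorems.TransportFieldFano

end
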